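import Summits.NavierStokesRegularity.FluidComputer.RowModelClosure
import HarnessLib

/-!
# The row model, part 3: regularity, the lock differentiated, the equal-phase and forcing identities,
# the forcing and coefficient bounds inside the tube

HONEST FRAMING (cell `pub-fluidc`, blueprint seat bp3, gen 20): low prior, high value-of-information
experiment on Tao's machine paradigm; NOT a claim that NS blows up.

This file is §2 of the text `RowModel` (split only for the 400-line rule; mathematics in the module docstring
of `RowModel.lean`, R1-DESIGN §9): on the part `[T₀, Ts]` of a row reached so far (`MemberOn Ts`, `Ts ≤ T₁`),
`e`, `z` are continuous with right derivatives `ed`, `K z + f`; the lock differentiated gives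
`ṡ (x̂′_p + Ṽ_p) = x̂′_p` (`phase_deriv`, derivative uniqueness on `[t, Ts]`), hence inside the tube
`|ṡ − 1| ≤ ρ` (`sd_facts`), `ė = ṡ P̃ Ṽ` (`ed_eq`), the forcing identity (`f_eq`) and the table bounds
`|f| ≤ φ` (`f_le`), `|K + cI| ≤ B` (`K_le`).

[cite: Tao2016AveragedNS, §5.5 Thm 5.3 (5.5)]
-/

noncomputable section

namespace Summit.NavierStokesRegularity.FluidComputer

namespace RowModel

open Set Real Filter Topology Matrix
open Literature.Analysis.ODE ImplicitMajorant

variable {ι : Type*} {κ : Type*} [Fintype ι] [Fintype κ] (R : RowModel ι κ) [DecidableEq κ] [DecidableEq ι]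
variable {R}

/-- `0 < 2^S h`. [folklore] -/
theorem Hb_pos (hc : R.Cert) : 0 < R.Hb := mul_pos (pow_pos two_pos _) hc.hh

/-- `T₀ ≤ T₁`. [folklore] -/
theorem T₀_le_T₁ (hc : R.Cert) : R.T₀ ≤ R.T₁ :=
  le_add_of_nonneg_right (mul_nonneg (Nat.cast_nonneg _) (Hb_pos hc).le)

/-- `e` is continuous on the row. [folklore] -/
theorem continuousOn_e (hc : R.Cert) {Ts : ℝ} (hm : R.MemberOn Ts) (a : κ) :
    ContinuousOn (fun t => R.e t a) (Icc R.T₀ Ts) := by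
  intro t ht
  have h1 : ContinuousWithinAt (fun r => R.y (R.s r) a) (Icc R.T₀ Ts) t :=
    (hm.hy (R.s t) (hm.hsD t ht) a).continuousAt.comp_continuousWithinAt (hm.hsc t ht)
  show ContinuousWithinAt (fun r => R.y (R.s r) a - R.xh r a) (Icc R.T₀ Ts) t
  exact h1.sub (hc.hxh t a).continuousAt.continuousWithinAt

/-- `z` is continuous on the row. [folklore] -/
theorem continuousOn_z (hc : R.Cert) {Ts : ℝ} (hm : R.MemberOn Ts) (i : ι) :
    ContinuousOn (fun t => R.z t i) (Icc R.T₀ Ts) := by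
  have hAm : ∀ b, Continuous fun r => R.Am r i b := fun b =>
    continuous_iff_continuousAt.2 fun r => (hc.hA r i b).continuousAt
  show ContinuousOn (fun t => ∑ b, R.Am t i b * R.e t b) (Icc R.T₀ Ts)
  exact continuousOn_finsetSum _ fun b _ => (hAm b).continuousOn.mul (continuousOn_e hc hm b)

/-- The right derivative of `e` in reference time is `ed`. [folklore] -/
theorem hasDerivWithinAt_e (hc : R.Cert) {Ts : ℝ} (hm : R.MemberOn Ts) {t : ℝ}
    (ht : t ∈ Ico R.T₀ Ts) (a : κ) : HasDerivWithinAt (fun r => R.e r a) (R.ed t a) (Ici t) t := by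
  have hsD := hm.hsD t (Ico_subset_Icc_self ht)
  have h1 : HasDerivWithinAt (fun r => R.y (R.s r) a)
      ((R.F (R.y (R.s t)) a + R.δF (R.s t) a) * R.sd t) (Ici t) t :=
    (hm.hy (R.s t) hsD a).comp_hasDerivWithinAt t (hm.hsd t ht)
  have h2 := h1.sub (hc.hxh t a).hasDerivWithinAt
  show HasDerivWithinAt (fun r => R.y (R.s r) a - R.xh r a) (R.ed t a) (Ici t) t
  refine h2.congr_deriv ?_
  simp only [RowModel.ed]
  ring

/-- The right derivative of `z`: `ż = K z + f` (trivially, `f` being the remainder). [folklore] -/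
theorem hasDerivWithinAt_z (hc : R.Cert) {Ts : ℝ} (hm : R.MemberOn Ts) {t : ℝ}
    (ht : t ∈ Ico R.T₀ Ts) (i : ι) : HasDerivWithinAt (fun r => R.z r i) (∑ j, R.Kf t i j * R.z t j + R.f t i)
      (Ici t) t := by
  have h1 : HasDerivWithinAt (fun r => ∑ b, R.Am r i b * R.e r b)
      (∑ b, (R.Am' t i b * R.e t b + R.Am t i b * R.ed t b)) (Ici t) t :=
    HasDerivWithinAt.fun_sum fun b _ =>
      (hc.hA t i b).hasDerivWithinAt.mul (hasDerivWithinAt_e hc hm ht b)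
  have h2 : ∑ j, R.Kf t i j * R.z t j + R.f t i
      = ∑ b, (R.Am' t i b * R.e t b + R.Am t i b * R.ed t b) := by
    simp only [RowModel.f, RowModel.zd, Pi.sub_apply, Pi.add_apply, Matrix.mulVec_apply_eq_sum,
      Finset.sum_add_distrib]
    ring
  rw [h2]
  exact h1

/-- The reconstruction relation `|e| ≤ Gm |z| + Rm |e|` on the row. [folklore] -/
theorem rel_e (hc : R.Cert) {Ts : ℝ} (hm : R.MemberOn Ts) (hTs : Ts ≤ R.T₁) {t : ℝ}
    (ht : t ∈ Icc R.T₀ Ts) (a : κ) :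
    |R.e t a| ≤ ∑ i, R.Gm a i * |R.z t i| + ∑ b, R.Rm a b * |R.e t b| := by
  have ht' : t ∈ Icc R.T₀ R.T₁ := ⟨ht.1, ht.2.trans hTs⟩
  have hrec := hc.hrec t ht' (R.e t) (e_phase hm ht)
  have h1 : R.e t a = (R.G t *ᵥ R.z t) a + (R.Rr t *ᵥ R.e t) a := by
    have := congrFun hrec a
    simpa only [Pi.add_apply, RowModel.z] using this.symm
  rw [h1]
  refine (abs_add_le _ _).trans (add_le_add ?_ ?_)
  · exact abs_mulVec_le (hc.hGm t ht') (fun j => le_rfl) a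
  · exact abs_mulVec_le (hc.hRm t ht') (fun j => le_rfl) a

/-- `F(y(s t)) + δF(s t) = x̂'(t) + Ṽ(t)` (Taylor split + definitions). [folklore] -/
theorem Fy_add (hc : R.Cert) (t : ℝ) (a : κ) :
    R.F (R.y (R.s t)) a + R.δF (R.s t) a = R.xh' t a + R.Vt t a := by
  rw [y_eq, hc.hF]
  simp only [RowModel.Vt, RowModel.w, RowModel.d, Pi.add_apply]
  ring

/-- Inside the tube, `|w| ≤ FQ + δ + DB`. [folklore] -/
theorem w_le (hc : R.Cert) {Ts : ℝ} (hm : R.MemberOn Ts) (hTs : Ts ≤ R.T₁) {t : ℝ}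
    (ht : t ∈ Icc R.T₀ Ts) (hEt : ∀ a, |R.e t a| ≤ R.Ebar a) (b : κ) :
    |R.w t b| ≤ R.FQ b + R.δ b + R.DB b := by
  have h1 := hc.hQ (R.e t) hEt b
  have h2 := hm.hδ t ht hEt b
  have h3 := hc.hDB t ⟨ht.1, ht.2.trans hTs⟩ b
  have ha := abs_add_le (R.Q (R.e t) b) (R.δF (R.s t) b)
  have hb := abs_sub (R.Q (R.e t) b + R.δF (R.s t) b) (R.xh' t b - R.F (R.xh t) b)
  simp only [RowModel.w, RowModel.d]
  linarith

/-- Inside the tube, `|Ṽ_p| ≤ D_p`. [folklore] -/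
theorem Vp_le (hc : R.Cert) {Ts : ℝ} (hm : R.MemberOn Ts) (hTs : Ts ≤ R.T₁) {t : ℝ}
    (ht : t ∈ Icc R.T₀ Ts) (hEt : ∀ a, |R.e t a| ≤ R.Ebar a) : |R.Vt t R.p| ≤ R.Dp := by
  have ht' : t ∈ Icc R.T₀ R.T₁ := ⟨ht.1, ht.2.trans hTs⟩
  have h1 : |(R.Jm t *ᵥ R.e t) R.p| ≤ ∑ b, R.Jpm b * R.Ebar b := by
    rw [Matrix.mulVec_apply_eq_sum]
    refine (Finset.abs_sum_le_sum_abs _ _).trans (Finset.sum_le_sum fun b _ => ?_)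
    rw [abs_mul]
    exact mul_le_mul (hc.hJp t ht' b) (hEt b) (abs_nonneg _)
      ((abs_nonneg _).trans (hc.hJp t ht' b))
  have h2 := w_le hc hm hTs ht hEt R.p
  have h3 := abs_add_le ((R.Jm t *ᵥ R.e t) R.p) (R.w t R.p)
  simp only [RowModel.Vt, RowModel.Dp, Pi.add_apply]
  linarith

/-- **The lock differentiated**: `ṡ (x̂'_p + Ṽ_p) = x̂'_p` (uniqueness of the derivative of
`x̂_p = y_p ∘ s` within `[t, Ts]`). [folklore] -/
theorem phase_deriv (hc : R.Cert) {Ts : ℝ} (hm : R.MemberOn Ts) {t : ℝ} (ht : t ∈ Ico R.T₀ Ts) :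
    R.sd t * (R.xh' t R.p + R.Vt t R.p) = R.xh' t R.p := by
  have hlt : t < Ts := ht.2
  have hsD := hm.hsD t (Ico_subset_Icc_self ht)
  have h1 : HasDerivWithinAt (fun r => R.y (R.s r) R.p)
      ((R.F (R.y (R.s t)) R.p + R.δF (R.s t) R.p) * R.sd t) (Icc t Ts) t :=
    ((hm.hy (R.s t) hsD R.p).comp_hasDerivWithinAt t (hm.hsd t ht)).mono Icc_subset_Ici_self
  have h2 : HasDerivWithinAt (fun r => R.xh r R.p)
      ((R.F (R.y (R.s t)) R.p + R.δF (R.s t) R.p) * R.sd t) (Icc t Ts) t :=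
    h1.congr_of_mem (fun r hr => (hm.hlock r ⟨ht.1.trans hr.1, hr.2⟩).symm) ⟨le_rfl, hlt.le⟩
  have h3 : HasDerivWithinAt (fun r => R.xh r R.p) (R.xh' t R.p) (Icc t Ts) t :=
    (hc.hxh t R.p).hasDerivWithinAt
  have h4 := (uniqueDiffOn_Icc hlt t ⟨le_rfl, hlt.le⟩).eq_deriv _ h3 h2
  rw [Fy_add hc] at h4
  linear_combination -h4

/-- Inside the tube: `x̂'_p ≠ 0`, `x̂'_p + Ṽ_p ≠ 0`, `ṡ = x̂'_p/(x̂'_p + Ṽ_p)` and `|ṡ − 1| ≤ ρ`.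
[folklore] -/
theorem sd_facts (hc : R.Cert) {Ts : ℝ} (hm : R.MemberOn Ts) (hTs : Ts ≤ R.T₁) {t : ℝ}
    (ht : t ∈ Ico R.T₀ Ts) (hEt : ∀ a, |R.e t a| ≤ R.Ebar a) :
    R.xh' t R.p ≠ 0 ∧ R.xh' t R.p + R.Vt t R.p ≠ 0 ∧
      R.sd t = R.xh' t R.p / (R.xh' t R.p + R.Vt t R.p) ∧ |R.sd t - 1| ≤ R.ρ := by
  have ht' : t ∈ Icc R.T₀ R.T₁ := ⟨ht.1, ht.2.le.trans hTs⟩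
  have hV := Vp_le hc hm hTs (Ico_subset_Icc_self ht) hEt
  have hΦ := hc.hΦ t ht'
  obtain ⟨hden, hratio⟩ := ratio_sub_one_le_abs hΦ hV hc.hDp
  have hΦ0 : R.xh' t R.p ≠ 0 := by
    intro h0
    rw [h0, abs_zero] at hΦ
    linarith [hc.hDp, (abs_nonneg _).trans hV]
  have hsd : R.sd t = R.xh' t R.p / (R.xh' t R.p + R.Vt t R.p) := by
    rw [eq_div_iff hden]
    exact phase_deriv hc hm ht
  refine ⟨hΦ0, hden, hsd, ?_⟩
  rw [hsd]
  exact hratio.trans hc.hρ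

/-- Inside the tube, **`ė = ṡ P̃ Ṽ`** (the equal-phase identity). [folklore] -/
theorem ed_eq (hc : R.Cert) {Ts : ℝ} (hm : R.MemberOn Ts) (hTs : Ts ≤ R.T₁) {t : ℝ}
    (ht : t ∈ Ico R.T₀ Ts) (hEt : ∀ a, |R.e t a| ≤ R.Ebar a) :
    R.ed t = R.sd t • (R.Pt t *ᵥ R.Vt t) := by
  obtain ⟨hΦ0, hden, hsd, -⟩ := sd_facts hc hm hTs ht hEt
  ext a
  rw [Pi.smul_apply, smul_eq_mul, Pt_mulVec, RowModel.ed, Fy_add hc]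
  exact Reparam.equalPhase_identity (F := R.xh' t) (V := R.Vt t) R.p hΦ0 hden hsd a

/-- Inside the tube, **the forcing identity** `f = (ȦR) e + ṡ ((AP̃JR) e + (AP̃) w)`. [folklore] -/
theorem f_eq (hc : R.Cert) {Ts : ℝ} (hm : R.MemberOn Ts) (hTs : Ts ≤ R.T₁) {t : ℝ}
    (ht : t ∈ Ico R.T₀ Ts) (hEt : ∀ a, |R.e t a| ≤ R.Ebar a) :
    R.f t = R.AmR t *ᵥ R.e t + R.sd t • (R.APJR t *ᵥ R.e t + R.APt t *ᵥ R.w t) := by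
  have ht' : t ∈ Icc R.T₀ R.T₁ := ⟨ht.1, ht.2.le.trans hTs⟩
  have hrec : R.G t *ᵥ R.z t + R.Rr t *ᵥ R.e t = R.e t :=
    hc.hrec t ht' (R.e t) (e_phase hm (Ico_subset_Icc_self ht))
  have hed := ed_eq hc hm hTs ht hEt
  simp only [RowModel.f, RowModel.zd, RowModel.Kf, RowModel.K0, RowModel.M, RowModel.APJR,
    RowModel.APJ, RowModel.APt, RowModel.AmR, hed, RowModel.Vt]
  exact forcing_identity hrec

/-- Inside the tube, **the forcing bound** `|f| ≤ φ`. [folklore] -/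
theorem f_le (hc : R.Cert) {Ts : ℝ} (hm : R.MemberOn Ts) (hTs : Ts ≤ R.T₁) {t : ℝ}
    (ht : t ∈ Ico R.T₀ Ts) (hEt : ∀ a, |R.e t a| ≤ R.Ebar a) (i : ι) : |R.f t i| ≤ R.φ i := by
  have ht' : t ∈ Icc R.T₀ R.T₁ := ⟨ht.1, ht.2.le.trans hTs⟩
  obtain ⟨-, -, -, hsd⟩ := sd_facts hc hm hTs ht hEt
  have hsd' : |R.sd t| ≤ 1 + R.ρ := by
    have := abs_sub_abs_le_abs_sub (R.sd t) 1
    rw [abs_one] at this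
    linarith
  have hwb := w_le hc hm hTs (Ico_subset_Icc_self ht) hEt
  have hw0 : ∀ b, 0 ≤ R.FQ b + R.δ b + R.DB b := fun b => (abs_nonneg _).trans (hwb b)
  have h1 : |(R.AmR t *ᵥ R.e t) i| ≤ ∑ b, |R.AmR t i b| * R.Ebar b :=
    abs_mulVec_le (fun _ _ => le_rfl) hEt i
  have h2 : |(R.APJR t *ᵥ R.e t) i| ≤ ∑ b, |R.APJR t i b| * R.Ebar b :=
    abs_mulVec_le (fun _ _ => le_rfl) hEt i
  have h3 : |(R.APt t *ᵥ R.w t) i| ≤ ∑ b, R.APm i b * (R.FQ b + R.δ b + R.DB b) :=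
    abs_mulVec_le (hc.hAPm t ht') hwb i
  have h4 : ∑ b, |R.AmR t i b| * R.Ebar b + (1 + R.ρ) * ∑ b, |R.APJR t i b| * R.Ebar b
      ≤ ∑ b, R.CF i b * R.Ebar b := by
    rw [Finset.mul_sum, ← Finset.sum_add_distrib]
    refine Finset.sum_le_sum fun b _ => ?_
    have := mul_le_mul_of_nonneg_right (hc.hCF t ht' i b) (hc.hEbar0 b)
    linarith
  have h5 : 0 ≤ ∑ b, |R.APJR t i b| * R.Ebar b :=
    Finset.sum_nonneg fun b _ => mul_nonneg (abs_nonneg _) (hc.hEbar0 b)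
  have h6 : 0 ≤ ∑ b, R.APm i b * (R.FQ b + R.δ b + R.DB b) :=
    Finset.sum_nonneg fun b _ => mul_nonneg ((abs_nonneg _).trans (hc.hAPm t ht' i b)) (hw0 b)
  have h7 := hc.hφ i
  rw [f_eq hc hm hTs ht hEt]
  simp only [Pi.add_apply, Pi.smul_apply, smul_eq_mul]
  have h8 : |R.sd t * ((R.APJR t *ᵥ R.e t) i + (R.APt t *ᵥ R.w t) i)|
      ≤ (1 + R.ρ) * (∑ b, |R.APJR t i b| * R.Ebar b
        + ∑ b, R.APm i b * (R.FQ b + R.δ b + R.DB b)) := by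
    rw [abs_mul]
    exact mul_le_mul hsd' ((abs_add_le _ _).trans (add_le_add h2 h3)) (abs_nonneg _)
      (by linarith [hc.hρ0])
  have h9 := abs_add_le ((R.AmR t *ᵥ R.e t) i)
    (R.sd t * ((R.APJR t *ᵥ R.e t) i + (R.APt t *ᵥ R.w t) i))
  nlinarith

/-- Inside the tube, **the coefficient bound** `|K + cI| ≤ B`. [folklore] -/
theorem K_le (hc : R.Cert) {Ts : ℝ} (hm : R.MemberOn Ts) (hTs : Ts ≤ R.T₁) {t : ℝ}
    (ht : t ∈ Ico R.T₀ Ts) (hEt : ∀ a, |R.e t a| ≤ R.Ebar a) (i j : ι) :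
    |R.Kf t i j + (if i = j then R.c else 0)| ≤ R.B i j := by
  obtain ⟨-, -, -, hsd⟩ := sd_facts hc hm hTs ht hEt
  have := hc.hKB t ⟨ht.1, ht.2.le.trans hTs⟩ (R.sd t) hsd i j
  simpa only [RowModel.Kf, Matrix.add_apply, Matrix.smul_apply, smul_eq_mul] using this

end RowModel

end Summit.NavierStokesRegularity.FluidComputer
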